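import Literature.MathematicalPhysics.QuantumLattice.HubbardLocalSpinOperators
import Literature.MathematicalPhysics.QuantumLattice.HubbardLiebBasis
import HarnessLib

/-!
# The second-order (superexchange) term of the Hubbard model on singly occupied configurations
# is the Heisenberg antiferromagnet: `P₀ T² P₀ = Σ_{x≠y} 2 t_{xy} t_{yx} (¼ − 𝐒_x·𝐒_y) P₀`

Topic `MathematicalPhysics/QuantumLattice` (family `hubbard`). The strong-coupling expansion of the
Hubbard model `H = T + U D` (`T = Σ_{x,y,σ} t_{xy} c†_{xσ} c_{yσ}`, `D = Σ_x n_{x↑} n_{x↓}`) around the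
atomic limit gives, to second order in `t/U`, the effective Hamiltonian
`P₀ T P₀ − U⁻¹ Σ_{m≥1} P₀ T P_m T P₀ / m` on the range of `P₀` (no doubly occupied site), Essler–Frahm–
Göhmann–Klümper–Korepin (2005) App. 2.A eq. (2.A.26). AT HALF FILLING the states in the range of `P₀`
are the "pure spin states" — every site SINGLY occupied — `P₀ T P₀ = 0`, one hop creates exactly one
doubly occupied site (`m = 1`), and the second-order term is the isotropic spin-½ Heisenberg model
`H_spin = Σ_{j≠k} (2|t_{jk}|²/U)(S_j·S_k − ¼)` (loc. cit. eq. (2.A.36); nearest neighbours: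
`(4t²/U) Σ_{⟨jk⟩} (S_j·S_k − ¼)`, eq. (2.A.37)); equivalently Takahashi (1999) §6.4 eq. (6.98),
`H_eff = Σ_{i<j} (t_{ij} t_{ji}/U)(σ_i·σ_j − 1)`, and Anderson's superexchange (Phys. Rev. 115 (1959) 2).

This file proves the OPERATOR IDENTITY behind these statements, in the tree's Jordan–Wigner model
(`HubbardWave0`: `Fock`, `Orb Λ = Λ ×ₗ Fin 2`, `creation`/`annihilation`, the LOCAL spin operators
`fermionSpinPlus/Minus/Z` and `fermionSpinDot x y = 𝐒_x·𝐒_y` of `HubbardLocalSpinOperators`), for an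
ARBITRARY hopping array `τ : Λ → Λ → ℂ` with zero diagonal (no Hermiticity needed) on an arbitrary finite
ordered site set: for SINGLY OCCUPIED configurations `u`, `s` (`x↑ ∈ s ↔ x↓ ∉ s` for every site `x`)

  `⟨u| T² |s⟩ = Σ_{x,y} τ_{xy} τ_{yx} · 2 (¼ δ_{us} − ⟨u| 𝐒_x·𝐒_y |s⟩)`
  (`hopping_mul_hopping_apply_of_singly`; sandwich form `diagonal_mul_hopping_sq_mul_diagonal`;
  quadratic form `star_dotProduct_hopping_sq_mulVec`),

and for the tree's graph Hubbard Hamiltonian at `U = 0`, `A = hamiltonian G t 0 = −t Σ_{x∼y,σ} c†_{xσ}c_{yσ}`: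
`⟨u| A² |s⟩ = t² Σ_{x∼y (ordered)} 2 (¼ δ_{us} − ⟨u|𝐒_x·𝐒_y|s⟩)` `= 4t² Σ_{edges} (¼ δ − 𝐒_x·𝐒_y)`
(`hamiltonian_zero_sq_apply_of_singly`, `star_dotProduct_hamiltonian_zero_sq_mulVec`). Combined with Kato's
second-order reduction (`StrongCouplingSecondOrderLimit`: `U · E_sector(T + U D) → E_{K₀}(−T²)` when
`P₀ T P₀ = 0` and the gap is `1`) this is the statement that the large-`U` half-filled Hubbard model is the
Heisenberg antiferromagnet with `J = 4t²/U` at the level of sector ground-state energies.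

## The mechanism (Essler et al. App. 2.A, the text between (2.A.31) and (2.A.32); proved here entrywise)

* `hop_mul_hop_apply_eq_zero_of_singly`: between singly occupied configurations a product of two hops
  `c†_{xσ} c_{yσ} · c†_{x'σ'} c_{y'σ'}` has a nonzero entry only if the second hop RETURNS along the bond
  of the first, `(x, y) = (y', x')` (the intermediate configuration has its unique doublon at `x'` and its
  unique hole at `y'`);
* `sum_sum_hop_mul_hop_eq` (CAR algebra, any configuration): the return processes along one bond sum to
  `Σ_{σσ'} c†_{bσ} c_{aσ} c†_{aσ'} c_{bσ'} = Σ_σ n_{bσ}(1 − n_{aσ}) + 2 S^z_b S^z_a − 2 𝐒_a·𝐒_b`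
  (same spin: `n_b (1 − n_a)`; opposite spins: minus a spin flip–flop `S^±_b S^∓_a`);
* `sum_sum_hop_mul_hop_apply_of_singly`: on a singly occupied configuration the diagonal part is `½`, so
  the bond operator acts as `2 (¼ − 𝐒_a·𝐒_b)` (`= 1 −` spin exchange).

Everything is a proved theorem; no definition, no named fact. NOT here: the reduction of the quadratic
form to the `2^{|Λ|}`-dimensional spin space / the tree's `heisenbergHamiltonian` on `Op Λ 2` (the
fermionic `𝐒_x·𝐒_y` act on Fock space and preserve single occupancy; an explicit unitary to
`SpinSystem` is not constructed), the `t`-`J` model away from half filling ((2.A.33)–(2.A.34)), and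
higher orders.

## References
* F. H. L. Essler, H. Frahm, F. Göhmann, A. Klümper, V. E. Korepin, *The One-Dimensional Hubbard Model*
  (CUP 2005), Appendix 2.A "The strong coupling limit", eqs. (2.A.26), (2.A.31)–(2.A.37).
  [cite: EsslerEtAl2005, App. 2.A eq. (2.A.26)–(2.A.37)]
* M. Takahashi, *Thermodynamics of One-Dimensional Solvable Models* (CUP 1999), §6.4 eqs. (6.96)–(6.98).
  [cite: Takahashi1999, §6.4 eq. (6.98)]
* P. W. Anderson, *New approach to the theory of superexchange interactions*, Phys. Rev. 115 (1959) 2.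
-/

noncomputable section

namespace Literature.MathematicalPhysics.QuantumLattice

open Matrix Finset HubbardWave0 LiebThm1

variable {Λ : Type*} [LinearOrder Λ] [Fintype Λ]

/-! ### Singly occupied configurations (pure spin states): bookkeeping -/

omit [LinearOrder Λ] [Fintype Λ] in
/-- In a singly occupied configuration an occupied spin orbital at a site excludes the other one.
[folklore] -/
private theorem orb_not_mem_of_mem {s : Finset (Orb Λ)} (hs : ∀ z : Λ, orb z 0 ∈ s ↔ orb z 1 ∉ s)
    {z : Λ} {σ ρ : Fin 2} (h : orb z σ ∈ s) (hσρ : σ ≠ ρ) : orb z ρ ∉ s := by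
  have h' := hs z
  fin_cases σ <;> fin_cases ρ
  · exact absurd rfl hσρ
  · exact h'.1 h
  · exact fun h0 => h'.1 h0 h
  · exact absurd rfl hσρ

omit [Fintype Λ] in
/-- In a singly occupied configuration an empty spin orbital at a site forces the other one to be
occupied. [folklore] -/
private theorem orb_mem_of_not_mem {s : Finset (Orb Λ)} (hs : ∀ z : Λ, orb z 0 ∈ s ↔ orb z 1 ∉ s)
    {z : Λ} {σ ρ : Fin 2} (h : orb z σ ∉ s) (hσρ : σ ≠ ρ) : orb z ρ ∈ s := by
  have h' := hs z
  fin_cases σ <;> fin_cases ρ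
  · exact absurd rfl hσρ
  · by_contra h1
    exact h (h'.2 h1)
  · exact h'.2 h
  · exact absurd rfl hσρ

omit [Fintype Λ] in
/-- Every site of a singly occupied configuration carries an electron. [folklore] -/
private theorem exists_orb_mem {s : Finset (Orb Λ)} (hs : ∀ z : Λ, orb z 0 ∈ s ↔ orb z 1 ∉ s)
    (z : Λ) : ∃ ρ : Fin 2, orb z ρ ∈ s := by
  by_cases h0 : orb z 0 ∈ s
  · exact ⟨0, h0⟩
  · exact ⟨1, orb_mem_of_not_mem hs h0 (by decide)⟩

/-! ### CAR algebra of two hops along one bond -/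

section CAR

variable {ι : Type*} [LinearOrder ι] [Fintype ι]

/-- Hop out and back with the same fermion: `c†_p c_q c†_q c_p = n_p − n_p n_q` (`p ≠ q`). [folklore] -/
private theorem hop_mul_hop_back {p q : ι} (hpq : p ≠ q) :
    creation p * annihilation q * (creation q * annihilation p) =
      creation p * annihilation p - creation p * annihilation p * (creation q * annihilation q) := by
  have h1 : annihilation q * creation q = 1 - creation q * annihilation q := by
    rw [annihilation_mul_creation, if_pos rfl]
  rw [creation_annihilation_mul_creation_annihilation_of_ne hpq]
  calc creation p * annihilation q * (creation q * annihilation p)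
      = creation p * (annihilation q * creation q) * annihilation p := by noncomm_ring
    _ = creation p * annihilation p - creation p * creation q * annihilation q * annihilation p := by
        rw [h1]; noncomm_ring

/-- Two hops exchanging two different fermions across a bond are minus a product of two on-site
flips: `c†_P c_Q c†_R c_S = −(c†_P c_S)(c†_R c_Q)` (`Q ≠ R`, `S ≠ R`). [folklore] -/
private theorem hop_mul_hop_eq_neg {P Q R S : ι} (hQR : Q ≠ R) (hSR : S ≠ R) :
    creation P * annihilation Q * (creation R * annihilation S) =
      -(creation P * annihilation S * (creation R * annihilation Q)) := by
  rw [creation_annihilation_mul_creation_annihilation_of_ne hQR,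
    creation_annihilation_mul_creation_annihilation_of_ne hSR]
  have h := annihilation_mul_annihilation_eq_neg (ι := ι) S Q
  calc creation P * creation R * annihilation S * annihilation Q
      = creation P * creation R * (annihilation S * annihilation Q) := by noncomm_ring
    _ = creation P * creation R * (-(annihilation Q * annihilation S)) := by rw [h]
    _ = -(creation P * creation R * annihilation Q * annihilation S) := by noncomm_ring

end CAR

/-- **The bond operator of the two return processes** (Essler et al. (2005) App. 2.A, the reduction
(2.A.31) → (2.A.32): only `k' = k` survives, same-spin returns give `n (1 − n)`, opposite-spin returns a
spin exchange): for distinct sites `a ≠ b`,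
`Σ_{σ,σ'} c†_{bσ} c_{aσ} c†_{aσ'} c_{bσ'} = Σ_σ (n_{bσ} − n_{bσ} n_{aσ}) + 2 S^z_b S^z_a − 2 𝐒_a·𝐒_b`.
[cite: EsslerEtAl2005, App. 2.A eq. (2.A.31)–(2.A.32)] -/
theorem sum_sum_hop_mul_hop_eq {a b : Λ} (hab : a ≠ b) :
    (∑ σ : Fin 2, ∑ σ' : Fin 2,
        creation (orb b σ) * annihilation (orb a σ) * (creation (orb a σ') * annihilation (orb b σ')) :
          Matrix (Finset (Orb Λ)) (Finset (Orb Λ)) ℂ) =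
      (∑ σ : Fin 2, (numberOp b σ - numberOp b σ * numberOp a σ)) +
        (2 : ℂ) • (fermionSpinZ b * fermionSpinZ a) - (2 : ℂ) • fermionSpinDot a b := by
  have hne : ∀ σ ρ : Fin 2, orb b σ ≠ orb a ρ := fun σ ρ h => hab (orb_eq_orb_iff.1 h).1.symm
  have h01 : orb a (0 : Fin 2) ≠ orb a 1 := fun h => absurd (orb_eq_orb_iff.1 h).2 (by decide)
  simp only [Fin.sum_univ_two]
  rw [hop_mul_hop_back (hne 0 0), hop_mul_hop_back (hne 1 1),
    hop_mul_hop_eq_neg (P := orb b 0) h01 (hne 1 1),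
    hop_mul_hop_eq_neg (P := orb b 1) h01.symm (hne 0 0),
    fermionSpinDot_comm a b, fermionSpinDot_def]
  simp only [fermionSpinPlus_def, fermionSpinMinus_def, numberOp]
  module

/-- `S^z_x` is diagonal in the occupation basis: `S^z_x |s⟩ = ½ ([x↑ ∈ s] − [x↓ ∈ s]) |s⟩`.
[cite: EsslerEtAl2005, §2.2.5 eq. (2.66) and (2.71)–(2.73)] -/
theorem fermionSpinZ_eq_diagonal (x : Λ) :
    fermionSpinZ x = diagonal fun s : Finset (Orb Λ) =>
      (1 / 2 : ℂ) * ((if orb x 0 ∈ s then 1 else 0) - (if orb x 1 ∈ s then 1 else 0)) := by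
  rw [fermionSpinZ_def, numberOp_eq_diagonal, numberOp_eq_diagonal, diagonal_sub]
  ext u s
  by_cases h : u = s <;> simp [Matrix.smul_apply, h]

/-- The diagonal part of the bond operator is `½` on a singly occupied configuration (both relative
spin orientations). [folklore] -/
private theorem diagPart_apply_of_singly {a b : Λ} {s : Finset (Orb Λ)}
    (hs : ∀ z : Λ, orb z 0 ∈ s ↔ orb z 1 ∉ s) (u : Finset (Orb Λ)) :
    ((∑ σ : Fin 2, (numberOp b σ - numberOp b σ * numberOp a σ)) +
        (2 : ℂ) • (fermionSpinZ b * fermionSpinZ a) : Matrix (Finset (Orb Λ)) (Finset (Orb Λ)) ℂ) u s =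
      if u = s then (1 / 2 : ℂ) else 0 := by
  by_cases h : u = s
  · rw [h]
    simp only [Matrix.add_apply, Matrix.sub_apply, Matrix.smul_apply, numberOp_eq_diagonal,
      fermionSpinZ_eq_diagonal, diagonal_mul_diagonal, diagonal_apply_eq, Fin.sum_univ_two, smul_eq_mul]
    have hA : ∀ z : Λ, orb z 0 ∉ s → orb z 1 ∈ s := fun z h0 => by
      by_contra h1
      exact h0 ((hs z).2 h1)
    by_cases ha : orb a 0 ∈ s <;> by_cases hb : orb b 0 ∈ s
    · have ha1 : orb a 1 ∉ s := (hs a).1 ha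
      have hb1 : orb b 1 ∉ s := (hs b).1 hb
      simp only [ha, hb, ha1, hb1, if_true, if_false]; norm_num
    · have ha1 : orb a 1 ∉ s := (hs a).1 ha
      have hb1 : orb b 1 ∈ s := hA b hb
      simp only [ha, hb, ha1, hb1, if_true, if_false]; norm_num
    · have ha1 : orb a 1 ∈ s := hA a ha
      have hb1 : orb b 1 ∉ s := (hs b).1 hb
      simp only [ha, hb, ha1, hb1, if_true, if_false]; norm_num
    · have ha1 : orb a 1 ∈ s := hA a ha
      have hb1 : orb b 1 ∈ s := hA b hb
      simp only [ha, hb, ha1, hb1, if_true, if_false]; norm_num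
  · simp only [Matrix.add_apply, Matrix.sub_apply, Matrix.smul_apply, numberOp_eq_diagonal,
      fermionSpinZ_eq_diagonal, diagonal_mul_diagonal, diagonal_apply_ne _ h, Fin.sum_univ_two, smul_zero,
      sub_zero, add_zero, if_neg h]

/-- **On a singly occupied configuration the bond operator is `1 −` spin exchange**
`= 2 (¼ − 𝐒_a·𝐒_b)`: `⟨u| Σ_{σσ'} c†_{bσ} c_{aσ} c†_{aσ'} c_{bσ'} |s⟩ = 2 (¼ δ_{us} − ⟨u|𝐒_a·𝐒_b|s⟩)` for
`s` singly occupied (Essler et al. (2005) App. 2.A: (2.A.33)–(2.A.34) reduce to (2.A.36) on pure spin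
states). [cite: EsslerEtAl2005, App. 2.A eq. (2.A.36)] -/
theorem sum_sum_hop_mul_hop_apply_of_singly {a b : Λ} (hab : a ≠ b) {s : Finset (Orb Λ)}
    (hs : ∀ z : Λ, orb z 0 ∈ s ↔ orb z 1 ∉ s) (u : Finset (Orb Λ)) :
    (∑ σ : Fin 2, ∑ σ' : Fin 2,
        creation (orb b σ) * annihilation (orb a σ) * (creation (orb a σ') * annihilation (orb b σ')) :
          Matrix (Finset (Orb Λ)) (Finset (Orb Λ)) ℂ) u s =
      2 * ((1 / 4 : ℂ) * (1 : Matrix (Finset (Orb Λ)) (Finset (Orb Λ)) ℂ) u s - fermionSpinDot a b u s) := by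
  rw [sum_sum_hop_mul_hop_eq hab, Matrix.sub_apply, diagPart_apply_of_singly hs u, Matrix.smul_apply, smul_eq_mul,
    Matrix.one_apply]
  split_ifs <;> ring

/-! ### Two hops between singly occupied configurations must return along the same bond -/

/-- **Support of a product of two hops between pure spin states** (Essler et al. (2005) App. 2.A, the
`k' = k` reduction after (2.A.31); Takahashi (1999) §6.4): if `u`, `s` are singly occupied, `x ≠ y`,
`x' ≠ y'`, and `(x, y) ≠ (y', x')`, then `⟨u| c†_{xσ} c_{yσ} c†_{x'σ'} c_{y'σ'} |s⟩ = 0` — the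
intermediate configuration has its only doubly occupied site at `x'` and its only empty site at `y'`,
and a single hop back to a singly occupied configuration must undo both.
[cite: EsslerEtAl2005, App. 2.A eq. (2.A.31)–(2.A.32)] -/
theorem hop_mul_hop_apply_eq_zero_of_singly {x y x' y' : Λ} (hx'y' : x' ≠ y') (σ σ' : Fin 2)
    {u s : Finset (Orb Λ)} (hu : ∀ z : Λ, orb z 0 ∈ u ↔ orb z 1 ∉ u)
    (hs : ∀ z : Λ, orb z 0 ∈ s ↔ orb z 1 ∉ s) (h : ¬(x = y' ∧ y = x')) :
    (creation (orb x σ) * annihilation (orb y σ) * (creation (orb x' σ') * annihilation (orb y' σ')) :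
        Matrix (Finset (Orb Λ)) (Finset (Orb Λ)) ℂ) u s = 0 := by
  by_contra hne
  rw [Matrix.mul_apply] at hne
  obtain ⟨w, -, hw⟩ := Finset.exists_ne_zero_of_sum_ne_zero hne
  obtain ⟨-, -, hw1⟩ := LiebTwo.creation_mul_annihilation_apply_ne_zero (left_ne_zero_of_mul hw)
  obtain ⟨hx'w, hy'w, hs2⟩ := LiebTwo.creation_mul_annihilation_apply_ne_zero (right_ne_zero_of_mul hw)
  -- `hw1 : w = insert (orb y σ) (u.erase (orb x σ))`,
  -- `hs2 : s = insert (orb y' σ') (w.erase (orb x' σ'))`, `hx'w : orb x' σ' ∈ w`,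
  -- `hy'w : orb y' σ' ∉ w.erase (orb x' σ')`.
  obtain ⟨τ', hστ'⟩ : ∃ τ' : Fin 2, σ' ≠ τ' := ⟨σ' + 1, by fin_cases σ' <;> decide⟩
  have hmem_w : ∀ o : Orb Λ, o ≠ orb x σ → o ∈ u → o ∈ w := fun o ho hou => by
    rw [hw1, Finset.mem_insert, Finset.mem_erase]
    exact Or.inr ⟨ho, hou⟩
  have hmem_s : ∀ o : Orb Λ, o ≠ orb x' σ' → o ∈ w → o ∈ s := fun o ho how => by
    rw [hs2, Finset.mem_insert, Finset.mem_erase]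
    exact Or.inr ⟨ho, how⟩
  -- (i) the intermediate configuration `w` is doubly occupied at `x'`
  have hx's : orb x' σ' ∉ s := by
    rw [hs2, Finset.mem_insert, Finset.mem_erase]
    rintro (e | ⟨hne', -⟩)
    · exact hx'y' (orb_eq_orb_iff.1 e).1
    · exact hne' rfl
  have hx'τw : orb x' τ' ∈ w := by
    have hx'τs : orb x' τ' ∈ s := orb_mem_of_not_mem hs hx's hστ'
    rw [hs2, Finset.mem_insert, Finset.mem_erase] at hx'τs
    rcases hx'τs with e | ⟨-, hmem⟩
    · exact absurd (orb_eq_orb_iff.1 e).1 hx'y'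
    · exact hmem
  -- (ii) hence `x' = y`: `u` is singly occupied and `w = u − x_σ + y_σ`
  have key : ∀ ρ : Fin 2, orb x' ρ ∈ w → orb x' ρ = orb y σ ∨ orb x' ρ ∈ u := fun ρ hρ => by
    rw [hw1, Finset.mem_insert, Finset.mem_erase] at hρ
    rcases hρ with e | ⟨-, hmem⟩
    · exact Or.inl e
    · exact Or.inr hmem
  have hx'y : x' = y := by
    rcases key σ' hx'w with e | hσu
    · exact (orb_eq_orb_iff.1 e).1
    · rcases key τ' hx'τw with e | hτu
      · exact (orb_eq_orb_iff.1 e).1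
      · exact absurd hτu (orb_not_mem_of_mem hu hσu hστ')
  -- (iii) the intermediate configuration `w` is empty at `y'`
  have hy'σw : orb y' σ' ∉ w := fun hmem =>
    hy'w (Finset.mem_erase.2 ⟨fun e => hx'y' (orb_eq_orb_iff.1 e).1.symm, hmem⟩)
  have hy'w_all : ∀ ρ : Fin 2, orb y' ρ ∉ w := by
    intro ρ hmem
    by_cases hρ : ρ = σ'
    · subst hρ
      exact hy'σw hmem
    · have hy'σs : orb y' σ' ∈ s := by
        rw [hs2]
        exact Finset.mem_insert_self _ _
      have hy'ρs : orb y' ρ ∉ s := orb_not_mem_of_mem hs hy'σs (fun e => hρ e.symm)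
      exact hy'ρs (hmem_s _ (fun e => hx'y' (orb_eq_orb_iff.1 e).1.symm) hmem)
  -- (iv) hence `y' = x`: `u` has an electron at `y'`, which survives into `w` unless it is `x_σ`
  have hy'x : y' = x := by
    obtain ⟨ρ, hρ⟩ := exists_orb_mem hu y'
    by_contra hne'
    exact hy'w_all ρ (hmem_w _ (fun e => hne' (orb_eq_orb_iff.1 e).1) hρ)
  exact h ⟨hy'x.symm, hx'y.symm⟩

/-! ### The second-order term on pure spin states is the Heisenberg exchange -/

/-- **`P₀ T² P₀` is the Heisenberg model on pure spin states, entrywise** (Essler et al. (2005) App. 2.A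
eq. (2.A.26) with `m = 1` and eq. (2.A.36); Takahashi (1999) eq. (6.98)): for a hopping array `τ` with
zero diagonal, `T = Σ_{x,y,σ} τ_{xy} c†_{xσ} c_{yσ}`, and singly occupied configurations `u`, `s`,
`⟨u| T² |s⟩ = Σ_{x,y} τ_{xy} τ_{yx} · 2 (¼ δ_{us} − ⟨u| 𝐒_x·𝐒_y |s⟩)`.
[cite: EsslerEtAl2005, App. 2.A eq. (2.A.26) and (2.A.36)] -/
theorem hopping_mul_hopping_apply_of_singly (τ : Λ → Λ → ℂ) (hτ : ∀ x, τ x x = 0)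
    {u s : Finset (Orb Λ)} (hu : ∀ z : Λ, orb z 0 ∈ u ↔ orb z 1 ∉ u)
    (hs : ∀ z : Λ, orb z 0 ∈ s ↔ orb z 1 ∉ s) :
    ((∑ x : Λ, ∑ y : Λ, ∑ σ : Fin 2,
        τ x y • (creation (orb x σ) * annihilation (orb y σ) : Matrix (Finset (Orb Λ)) (Finset (Orb Λ)) ℂ)) *
      (∑ x : Λ, ∑ y : Λ, ∑ σ : Fin 2,
        τ x y • (creation (orb x σ) * annihilation (orb y σ) : Matrix (Finset (Orb Λ)) (Finset (Orb Λ)) ℂ)))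
        u s =
      ∑ x : Λ, ∑ y : Λ, τ x y * τ y x *
        (2 * ((1 / 4 : ℂ) * (1 : Matrix (Finset (Orb Λ)) (Finset (Orb Λ)) ℂ) u s - fermionSpinDot x y u s)) := by
  -- bilinear expansion, entrywise
  simp only [Finset.sum_mul]
  simp only [Finset.mul_sum]
  simp only [smul_mul_assoc, mul_smul_comm, smul_smul, Matrix.sum_apply, Matrix.smul_apply, smul_eq_mul]
  refine Finset.sum_congr rfl fun x _ => Finset.sum_congr rfl fun y _ => ?_
  -- goal: `Σ_σ Σ_x' Σ_y' τ x' y' * τ x y * Σ_σ' ⟨u| c†_{xσ}c_{yσ} c†_{x'σ'}c_{y'σ'} |s⟩ = τ x y * τ y x * 2 (…)`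
  rcases eq_or_ne x y with rfl | hxy
  · simp [hτ x]
  -- every term with `(x', y') ≠ (y, x)` vanishes
  have hvan : ∀ (σ : Fin 2) (x' y' : Λ), ¬(x' = y ∧ y' = x) →
      τ x' y' * τ x y * ∑ σ' : Fin 2, (creation (orb x σ) * annihilation (orb y σ) *
        (creation (orb x' σ') * annihilation (orb y' σ')) : Matrix (Finset (Orb Λ)) (Finset (Orb Λ)) ℂ) u s
        = 0 := by
    intro σ x' y' hne
    rcases eq_or_ne x' y' with rfl | hx'y'
    · rw [hτ x', zero_mul, zero_mul]
    · rw [Finset.sum_eq_zero fun σ' _ =>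
        hop_mul_hop_apply_eq_zero_of_singly hx'y' σ σ' hu hs (fun hh => hne ⟨hh.2.symm, hh.1.symm⟩), mul_zero]
  have hstep : ∀ σ : Fin 2,
      (∑ x' : Λ, ∑ y' : Λ, τ x' y' * τ x y * ∑ σ' : Fin 2,
        (creation (orb x σ) * annihilation (orb y σ) *
          (creation (orb x' σ') * annihilation (orb y' σ')) : Matrix (Finset (Orb Λ)) (Finset (Orb Λ)) ℂ) u s)
        = τ y x * τ x y * ∑ σ' : Fin 2,
          (creation (orb x σ) * annihilation (orb y σ) *
            (creation (orb y σ') * annihilation (orb x σ')) : Matrix (Finset (Orb Λ)) (Finset (Orb Λ)) ℂ) u s := by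
    intro σ
    have h1 : ∀ x' ∈ (Finset.univ : Finset Λ), x' ≠ y →
        (∑ y' : Λ, τ x' y' * τ x y * ∑ σ' : Fin 2,
          (creation (orb x σ) * annihilation (orb y σ) *
            (creation (orb x' σ') * annihilation (orb y' σ')) : Matrix (Finset (Orb Λ)) (Finset (Orb Λ)) ℂ) u s)
          = 0 := fun x' _ hx' =>
      Finset.sum_eq_zero fun y' _ => hvan σ x' y' (fun hh => hx' hh.1)
    rw [Finset.sum_eq_single_of_mem y (Finset.mem_univ _) h1]
    have h2 : ∀ y' ∈ (Finset.univ : Finset Λ), y' ≠ x →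
        τ y y' * τ x y * ∑ σ' : Fin 2,
          (creation (orb x σ) * annihilation (orb y σ) *
            (creation (orb y σ') * annihilation (orb y' σ')) : Matrix (Finset (Orb Λ)) (Finset (Orb Λ)) ℂ) u s
          = 0 := fun y' _ hy' => hvan σ y y' (fun hh => hy' hh.2)
    rw [Finset.sum_eq_single_of_mem x (Finset.mem_univ _) h2]
  simp only [hstep, ← Finset.mul_sum]
  -- the two return processes along the bond `{x, y}`
  have hbond := sum_sum_hop_mul_hop_apply_of_singly hxy.symm hs u
  simp only [Matrix.sum_apply] at hbond
  rw [hbond, fermionSpinDot_comm y x]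
  ring

/-- **Sandwich form** `P T² P = P (Σ_{x,y} τ_{xy} τ_{yx} · 2 (¼ − 𝐒_x·𝐒_y)) P` for every diagonal
matrix `P = diagonal p` supported on singly occupied configurations (`P₀` of Essler et al. at half
filling, or its restriction to one `S^z` sector). [cite: EsslerEtAl2005, App. 2.A eq. (2.A.26) and (2.A.36)] -/
theorem diagonal_mul_hopping_sq_mul_diagonal (τ : Λ → Λ → ℂ) (hτ : ∀ x, τ x x = 0)
    (p : Finset (Orb Λ) → ℂ) (hp : ∀ s, p s ≠ 0 → ∀ z : Λ, orb z 0 ∈ s ↔ orb z 1 ∉ s) :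
    diagonal p *
        ((∑ x : Λ, ∑ y : Λ, ∑ σ : Fin 2,
          τ x y • (creation (orb x σ) * annihilation (orb y σ) : Matrix (Finset (Orb Λ)) (Finset (Orb Λ)) ℂ)) *
        (∑ x : Λ, ∑ y : Λ, ∑ σ : Fin 2,
          τ x y • (creation (orb x σ) * annihilation (orb y σ) : Matrix (Finset (Orb Λ)) (Finset (Orb Λ)) ℂ))) *
      diagonal p =
    diagonal p *
        (∑ x : Λ, ∑ y : Λ, (τ x y * τ y x) •
          ((2 : ℂ) • ((1 / 4 : ℂ) • (1 : Matrix (Finset (Orb Λ)) (Finset (Orb Λ)) ℂ) - fermionSpinDot x y))) *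
      diagonal p := by
  ext u s
  simp only [mul_diagonal, diagonal_mul]
  by_cases hu : p u = 0
  · rw [hu, zero_mul, zero_mul, zero_mul, zero_mul]
  by_cases hs : p s = 0
  · rw [hs, mul_zero, mul_zero]
  rw [hopping_mul_hopping_apply_of_singly τ hτ (hp u hu) (hp s hs)]
  simp only [Matrix.sum_apply, Matrix.smul_apply, Matrix.sub_apply, smul_eq_mul]

/-- Two matrices whose entries agree on the support of `ψ` have the same expectation in `ψ`. [folklore] -/
private theorem star_dotProduct_mulVec_congr {ι : Type*} [Fintype ι] {q : ι → Prop}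
    {M R : Matrix ι ι ℂ} {ψ : ι → ℂ} (hψ : ∀ i, ψ i ≠ 0 → q i)
    (h : ∀ i j, q i → q j → M i j = R i j) : star ψ ⬝ᵥ (M *ᵥ ψ) = star ψ ⬝ᵥ (R *ᵥ ψ) := by
  simp only [dotProduct, mulVec, Pi.star_apply]
  refine Finset.sum_congr rfl fun i _ => ?_
  by_cases hi : ψ i = 0
  · rw [hi, star_zero, zero_mul, zero_mul]
  · congr 1
    refine Finset.sum_congr rfl fun j _ => ?_
    by_cases hj : ψ j = 0
    · rw [hj, mul_zero, mul_zero]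
    · rw [h i j (hψ i hi) (hψ j hj)]

/-- **Quadratic form** of `T²` on a state supported on pure spin states (every configuration in the
support singly occupied): `⟨ψ| T² |ψ⟩ = Σ_{x,y} τ_{xy} τ_{yx} · 2 (¼ ‖ψ‖² − ⟨ψ| 𝐒_x·𝐒_y |ψ⟩)` — the
Heisenberg energy functional of Essler et al. (2005) eq. (2.A.36) (times `−U`) / Takahashi (1999)
eq. (6.98). [cite: EsslerEtAl2005, App. 2.A eq. (2.A.36)] -/
theorem star_dotProduct_hopping_sq_mulVec (τ : Λ → Λ → ℂ) (hτ : ∀ x, τ x x = 0) {ψ : Fock (Orb Λ)}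
    (hψ : ∀ s, ψ s ≠ 0 → ∀ z : Λ, orb z 0 ∈ s ↔ orb z 1 ∉ s) :
    star ψ ⬝ᵥ
        (((∑ x : Λ, ∑ y : Λ, ∑ σ : Fin 2,
            τ x y • (creation (orb x σ) * annihilation (orb y σ) : Matrix (Finset (Orb Λ)) (Finset (Orb Λ)) ℂ)) *
          (∑ x : Λ, ∑ y : Λ, ∑ σ : Fin 2,
            τ x y • (creation (orb x σ) * annihilation (orb y σ) : Matrix (Finset (Orb Λ)) (Finset (Orb Λ)) ℂ))) *ᵥ
          ψ) =
      ∑ x : Λ, ∑ y : Λ, τ x y * τ y x *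
        (2 * ((1 / 4 : ℂ) * (star ψ ⬝ᵥ ψ) - star ψ ⬝ᵥ (fermionSpinDot x y *ᵥ ψ))) := by
  rw [star_dotProduct_mulVec_congr (q := fun s : Finset (Orb Λ) => ∀ z : Λ, orb z 0 ∈ s ↔ orb z 1 ∉ s)
    (R := ∑ x : Λ, ∑ y : Λ, (τ x y * τ y x) •
      ((2 : ℂ) • ((1 / 4 : ℂ) • (1 : Matrix (Finset (Orb Λ)) (Finset (Orb Λ)) ℂ) - fermionSpinDot x y)))
    hψ (fun u s hu hs => by
      rw [hopping_mul_hopping_apply_of_singly τ hτ hu hs]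
      simp only [Matrix.sum_apply, Matrix.smul_apply, Matrix.sub_apply, smul_eq_mul])]
  simp only [Matrix.sum_mulVec, Matrix.smul_mulVec, Matrix.sub_mulVec, Matrix.one_mulVec, dotProduct_sum,
    dotProduct_smul, dotProduct_sub, smul_eq_mul]

/-! ### The graph Hubbard model: `A = hamiltonian G t 0`, `P₀ A² P₀ = 4t² Σ_{edges} (¼ − 𝐒_x·𝐒_y) P₀` -/

section Graph

variable (G : SimpleGraph Λ) [DecidableRel G.Adj]

/-- The tree's pure-hopping graph Hamiltonian `hamiltonian G t 0 = −t Σ_{x∼y, σ} c†_{xσ} c_{yσ}` is the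
hopping operator of the array `τ_{xy} = −t [x ∼ y]`. [cite: EsslerEtAl2005, App. 2.A eq. (2.A.37)] -/
theorem hamiltonian_zero_eq_hopping (t : ℝ) :
    hamiltonian G t 0 = ∑ x : Λ, ∑ y : Λ, ∑ σ : Fin 2,
      (if G.Adj x y then -(t : ℂ) else 0) •
        (creation (orb x σ) * annihilation (orb y σ) : Matrix (Finset (Orb Λ)) (Finset (Orb Λ)) ℂ) := by
  unfold hamiltonian
  rw [Complex.ofReal_zero, zero_smul, add_zero, Finset.smul_sum]
  refine Finset.sum_congr rfl fun x _ => ?_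
  rw [Finset.smul_sum]
  refine Finset.sum_congr rfl fun y _ => ?_
  rw [Finset.smul_sum]
  refine Finset.sum_congr rfl fun σ _ => ?_
  split_ifs <;> simp

/-- **`P₀ A² P₀` for the graph Hubbard model, entrywise**: for singly occupied `u`, `s`,
`⟨u| (hamiltonian G t 0)² |s⟩ = t² Σ_{x∼y (ordered pairs)} 2 (¼ δ_{us} − ⟨u|𝐒_x·𝐒_y|s⟩)`
`= 4t² Σ_{edges {x,y}} (¼ δ_{us} − ⟨u|𝐒_x·𝐒_y|s⟩)` — the antiferromagnetic Heisenberg model with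
`J = 4t²/U` after Kato's `−1/U` (Essler et al. (2005) eq. (2.A.37); Takahashi (1999) eq. (6.98)).
[cite: EsslerEtAl2005, App. 2.A eq. (2.A.37)] -/
theorem hamiltonian_zero_sq_apply_of_singly (t : ℝ) {u s : Finset (Orb Λ)}
    (hu : ∀ z : Λ, orb z 0 ∈ u ↔ orb z 1 ∉ u) (hs : ∀ z : Λ, orb z 0 ∈ s ↔ orb z 1 ∉ s) :
    (hamiltonian G t 0 * hamiltonian G t 0) u s =
      (t : ℂ) ^ 2 * ∑ x : Λ, ∑ y : Λ, if G.Adj x y then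
        2 * ((1 / 4 : ℂ) * (1 : Matrix (Finset (Orb Λ)) (Finset (Orb Λ)) ℂ) u s - fermionSpinDot x y u s) else 0 := by
  rw [hamiltonian_zero_eq_hopping,
    hopping_mul_hopping_apply_of_singly _ (fun x => if_neg (G.irrefl (v := x))) hu hs, Finset.mul_sum]
  refine Finset.sum_congr rfl fun x _ => ?_
  rw [Finset.mul_sum]
  refine Finset.sum_congr rfl fun y _ => ?_
  by_cases hxy : G.Adj x y
  · rw [if_pos hxy, if_pos hxy.symm, if_pos hxy]; ring
  · rw [if_neg hxy, if_neg (fun h => hxy h.symm), if_neg hxy]; ring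

/-- **Quadratic form of `A²` on a state supported on pure spin states**, `A = hamiltonian G t 0`:
`⟨ψ| A² |ψ⟩ = t² Σ_{x∼y (ordered)} 2 (¼ ‖ψ‖² − ⟨ψ|𝐒_x·𝐒_y|ψ⟩)` — so, through Kato's second-order
reduction, `lim_{U→∞} U · E_{sector}(hamiltonian G t U) = −min_{ψ} ⟨ψ|A²|ψ⟩/‖ψ‖²` over the pure spin states
of the sector is `4t²` times the sector ground-state energy of `Σ_{edges} (𝐒_x·𝐒_y − ¼)`.
[cite: EsslerEtAl2005, App. 2.A eq. (2.A.37)] -/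
theorem star_dotProduct_hamiltonian_zero_sq_mulVec (t : ℝ) {ψ : Fock (Orb Λ)}
    (hψ : ∀ s, ψ s ≠ 0 → ∀ z : Λ, orb z 0 ∈ s ↔ orb z 1 ∉ s) :
    star ψ ⬝ᵥ ((hamiltonian G t 0 * hamiltonian G t 0) *ᵥ ψ) =
      (t : ℂ) ^ 2 * ∑ x : Λ, ∑ y : Λ, if G.Adj x y then
        2 * ((1 / 4 : ℂ) * (star ψ ⬝ᵥ ψ) - star ψ ⬝ᵥ (fermionSpinDot x y *ᵥ ψ)) else 0 := by
  rw [hamiltonian_zero_eq_hopping,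
    star_dotProduct_hopping_sq_mulVec _ (fun x => if_neg (G.irrefl (v := x))) hψ, Finset.mul_sum]
  refine Finset.sum_congr rfl fun x _ => ?_
  rw [Finset.mul_sum]
  refine Finset.sum_congr rfl fun y _ => ?_
  by_cases hxy : G.Adj x y
  · rw [if_pos hxy, if_pos hxy.symm, if_pos hxy]; ring
  · rw [if_neg hxy, if_neg (fun h => hxy h.symm), if_neg hxy]; ring

end Graph

end Literature.MathematicalPhysics.QuantumLattice

end
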